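import Literature.NumberTheory.Sieve.ChenTheoremISwitchedRemainder
import Literature.NumberTheory.Sieve.ChenShiftedSwitchedSieve
import HarnessLib

/-!
# Chen's Theorem II: the remainder of the switching term for a fixed even shift `h` — PROVED

Sequel of `ChenShiftedSwitchedSieve.lean` (the sieve step of the bound (C) for the switched set of the
shifted problem, `B_h(x) = {p₁p₂p₃ − h}`, hypothesis (C) of
`Literature.NumberTheory.Sieve.Chen.Chen1973_theoremII_of`). This file proves the second of the three
steps: the remainder of the enlarged switched sequence `switchedSeqS h x ε` at level `D = x^{1/2−δ}` is
negligible,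

  `R_S(h, x, ε, x^{1/2−δ}) ≤ C(ε, δ) · x/(log x)³`  for all large `x`  (`switchedRemainderS_le`).

It is a transcription of `ChenTheoremISwitchedRemainder.lean` (the Goldbach set `{x − p₁p₂p₃}`,
`switchedRemainderT_le`) in which the rôle of the even number is split: the SIZE `x` (written `N` in the
proofs, as in the source: grid `gridLevelT N ε k`, `maxGridIndexT`, ranges, `y N = N^{1/3}` — all the
grid lemmas of that file are reused verbatim) and the fixed MODULUS `h` (the blocks `blockPrimesS`,
`blockPairsS`, `blockProductsS` carry `p ∤ h`, `(p₂p₃, h) = 1`; the congruence is `p₁p₂p₃ ≡ h (mod d)`,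
the density `shiftedPrimesDensity h`, the residue class `resClass h d`). The deep input is unchanged —
Nathanson's bilinear form inequality Theorem 10.7, PROVED in `ChenBilinearForm.lean`
(`Bilinear.primes_explicit`: the large sieve and the Siegel–Walfisz theorem; the block estimate takes a
supremum over ALL reduced residue classes, so it does not see the modulus), and the bookkeeping
`blockBound_arithT` of the Goldbach file. No named facts.

## References

* Chen Jing-run, Sci. Sinica 16 (1973) 157–176, Lemmas 5–7 and §III ("by the same method";
  reprint: Wang Yuan (ed.), *Goldbach Conjecture*, 1984, PDF pp. 157–168). [ChenSciSinica1973]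
* M. B. Nathanson, *Additive Number Theory: The Classical Bases*, GTM 164 (1996), Thm 10.6
  (proof, (10.12)–(10.15)) and Thm 10.7, pp. 289–295. [Nathanson1996]
-/

open Finset Filter Topology

noncomputable section

namespace Literature.NumberTheory.Sieve.Chen

open SieveSequence

/-! ### The blocks of `T̃(h, N, ε)` (size `N`, modulus `h`) -/

/-- The prime variable of block `k`: `P_k = {p prime : ℓ_k ≤ p < min(y, (1+ε)ℓ_k), p ∤ h}` (size `N`,
modulus `h`), in the shape of `Bilinear.primes_explicit` (`TY = ⌈min(y, (1+ε)ℓ_k)⌉`, `TZ = ⌈ℓ_k⌉`,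
`K = h`).
[cite: Nathanson1996, Thm 10.6 (proof, (10.13))] -/
def blockPrimesS (h N : ℕ) (ε : ℝ) (k : ℕ) : Finset ℕ :=
  (Nat.primesBelow ⌈min (y N) ((1 + ε) * gridLevelT N ε k)⌉₊).filter
    fun p => ⌈gridLevelT N ε k⌉₊ ≤ p ∧ ¬p ∣ h

/-- Membership in `P_k`. [folklore] -/
theorem mem_blockPrimesS {h N : ℕ} {ε : ℝ} {k p : ℕ} :
    p ∈ blockPrimesS h N ε k ↔ p.Prime ∧ gridLevelT N ε k ≤ p ∧ (p : ℝ) < y N ∧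
      (p : ℝ) < (1 + ε) * gridLevelT N ε k ∧ ¬p ∣ h := by
  rw [blockPrimesS, Finset.mem_filter, Nat.mem_primesBelow, Nat.lt_ceil, lt_min_iff, Nat.ceil_le]
  tauto

/-- The pairs of block `k`: `Q_k = {(p₂, p₃) : y ≤ p₂ ≤ p₃ < N primes, (p₂p₃, h) = 1, ℓ_k p₂p₃ < N}`.
[cite: Nathanson1996, Thm 10.6 (proof, (10.13))] -/
def blockPairsS (h N : ℕ) (ε : ℝ) (k : ℕ) : Finset (ℕ × ℕ) :=
  (Finset.range N ×ˢ Finset.range N).filter fun q : ℕ × ℕ =>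
    q.1.Prime ∧ q.2.Prime ∧ y N ≤ (q.1 : ℝ) ∧ q.1 ≤ q.2 ∧ (q.1 * q.2).Coprime h ∧
      gridLevelT N ε k * q.1 * q.2 < (N : ℝ)

/-- Membership in `Q_k`. [folklore] -/
theorem mem_blockPairsS {h N : ℕ} {ε : ℝ} {k : ℕ} {q : ℕ × ℕ} :
    q ∈ blockPairsS h N ε k ↔ (q.1 < N ∧ q.2 < N) ∧ q.1.Prime ∧ q.2.Prime ∧ y N ≤ (q.1 : ℝ) ∧
      q.1 ≤ q.2 ∧ (q.1 * q.2).Coprime h ∧ gridLevelT N ε k * q.1 * q.2 < (N : ℝ) := by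
  simp only [blockPairsS, Finset.mem_filter, Finset.mem_product, Finset.mem_range]

/-- The `n`-variable of block `k`: `M_k = {p₂p₃ : (p₂, p₃) ∈ Q_k}`. [cite: Nathanson1996, Thm 10.6 (proof, (10.15))] -/
def blockProductsS (h N : ℕ) (ε : ℝ) (k : ℕ) : Finset ℕ :=
  (blockPairsS h N ε k).image fun q : ℕ × ℕ => q.1 * q.2

/-- `#M_k = #Q_k`. [folklore] -/
theorem card_blockProductsS (h N : ℕ) (ε : ℝ) (k : ℕ) :
    #(blockProductsS h N ε k) = #(blockPairsS h N ε k) := by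
  unfold blockProductsS
  refine Finset.card_image_of_injOn (mul_injOn_primePairs _ fun q hq => ?_)
  obtain ⟨-, h1, h2, -, h12, -⟩ := mem_blockPairsS.mp hq
  exact ⟨h1, h2, h12⟩

/-- Counting over `Q_k` through `M_k`: `#{q ∈ Q_k : P(p₂p₃)} = #{m ∈ M_k : P(m)}`. [folklore] -/
theorem card_filter_blockPairsS_eq (h N : ℕ) (ε : ℝ) (k : ℕ) (P : ℕ → Prop) [DecidablePred P] :
    #((blockPairsS h N ε k).filter fun q : ℕ × ℕ => P (q.1 * q.2)) =
      #((blockProductsS h N ε k).filter P) := by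
  classical
  unfold blockProductsS
  rw [Finset.filter_image, Finset.card_image_of_injOn]
  refine mul_injOn_primePairs _ fun q hq => ?_
  obtain ⟨-, h1, h2, -, h12, -⟩ := mem_blockPairsS.mp (Finset.mem_filter.mp hq).1
  exact ⟨h1, h2, h12⟩

/-- Elements of `M_k`: `m = p₂p₃` with `y² ≤ m`, `ℓ_k m < N`, `(m, h) = 1`, and `m` has no prime
factor `< y`. [folklore] -/
theorem mem_blockProductsS {h N : ℕ} {ε : ℝ} {k m : ℕ} (hm : m ∈ blockProductsS h N ε k) :
    ∃ q ∈ blockPairsS h N ε k, q.1 * q.2 = m := by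
  unfold blockProductsS at hm
  simpa only [Finset.mem_image] using hm

/-- **The blocks are products**: `T_k = {t ∈ T̃ : k(p₁) = k} = P_k × Q_k` (as sets of
`ℕ × (ℕ × ℕ)`), for `N ≥ 2`, `0 < ε`. [cite: Nathanson1996, Thm 10.6 (proof, (10.13))] -/
theorem switchedTriplesS_filter_eq {h N : ℕ} {ε : ℝ} (hN : 2 ≤ N) (hε : 0 < ε) (k : ℕ) :
    (switchedTriplesS h N ε).filter (fun t : ℕ × ℕ × ℕ => chenGridIndexT N ε t.1 = k) =
      blockPrimesS h N ε k ×ˢ blockPairsS h N ε k := by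
  have hNpos : 0 < N := by omega
  have hN1 : (1 : ℝ) < N := by exact_mod_cast (show 1 < N by omega)
  obtain ⟨hℓ0, hzℓ⟩ := gridLevelT_pos hNpos hε k
  have hz1 : 1 ≤ (N : ℝ) ^ (1 / 10 : ℝ) := Real.one_le_rpow hN1.le (by norm_num)
  have hyN : y N < N := by
    have : y N < (N : ℝ) ^ (1 : ℝ) := Real.rpow_lt_rpow_of_exponent_lt hN1 (by norm_num)
    rwa [Real.rpow_one] at this
  ext t
  rw [Finset.mem_filter, mem_switchedTriplesS, Finset.mem_product, mem_blockPrimesS, mem_blockPairsS]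
  constructor
  · rintro ⟨⟨⟨-, h2N, h3N⟩, h₁, h₂, h₃, hz, hy, hy', h23, hndvd, hcop, hlt⟩, hk⟩
    obtain ⟨hℓp, hpℓ⟩ := (chenGridIndexT_eq_iff hNpos hε hz k).mp hk
    rw [chenGridPointT_eq_gridLevelT, hk] at hlt
    exact ⟨⟨h₁, hℓp, hy, hpℓ, hndvd⟩, ⟨h2N, h3N⟩, h₂, h₃, hy', h23, hcop, hlt⟩
  · rintro ⟨⟨h₁, hℓp, hy, hpℓ, hndvd⟩, ⟨h2N, h3N⟩, h₂, h₃, hy', h23, hcop, hlt⟩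
    have hz : (N : ℝ) ^ (1 / 10 : ℝ) ≤ (t.1 : ℝ) := hzℓ.trans hℓp
    have hk : chenGridIndexT N ε t.1 = k := (chenGridIndexT_eq_iff hNpos hε hz k).mpr ⟨hℓp, hpℓ⟩
    have h1N : t.1 < N := by exact_mod_cast hy.trans hyN
    refine ⟨⟨⟨h1N, h2N, h3N⟩, h₁, h₂, h₃, hz, hy, hy', h23, hndvd, hcop, ?_⟩, hk⟩
    rw [chenGridPointT_eq_gridLevelT, hk]
    exact hlt


/-! ### Counting in a block: the bilinear shape of `r_d^{(k)}` -/

/-- Elements of `M_k` are `≥ 1`, `< N/ℓ_k`, coprime to `h`, and coprime to every `d ∣ P(y)` (their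
prime factors are `≥ y`). [folklore] -/
theorem blockProductsS_props {h N : ℕ} {ε : ℝ} (hN : 0 < N) (hε : 0 < ε) {k m : ℕ}
    (hm : m ∈ blockProductsS h N ε k) :
    1 ≤ m ∧ (m : ℝ) < N / gridLevelT N ε k ∧ m.Coprime h ∧
      ∀ d : ℕ, d ∣ primesProdBelow (y N) → m.Coprime d := by
  obtain ⟨q, hq, rfl⟩ := mem_blockProductsS hm
  obtain ⟨-, h1, h2, hy1, h12, hcop, hlt⟩ := mem_blockPairsS.mp hq
  obtain ⟨hℓ0, -⟩ := gridLevelT_pos hN hε k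
  refine ⟨Nat.one_le_iff_ne_zero.mpr (Nat.mul_ne_zero h1.ne_zero h2.ne_zero), ?_, hcop, ?_⟩
  · rw [lt_div_iff₀ hℓ0]
    calc ((q.1 * q.2 : ℕ) : ℝ) * gridLevelT N ε k = gridLevelT N ε k * q.1 * q.2 := by push_cast; ring
      _ < N := hlt
  · intro d hd
    rw [Nat.coprime_mul_iff_left]
    have key : ∀ r : ℕ, r.Prime → y N ≤ (r : ℝ) → r.Coprime d := by
      intro r hr hyr
      rw [Nat.Prime.coprime_iff_not_dvd hr]
      intro hrd
      have hrP : r ∣ primesProdBelow (y N) := hrd.trans hd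
      rw [dvd_primesProdBelow_iff hr] at hrP
      linarith
    have hy2 : y N ≤ (q.2 : ℝ) := hy1.trans (by exact_mod_cast h12)
    exact ⟨key q.1 h1 hy1, key q.2 h2 hy2⟩

/-- The prime variable `P_k` consists of primes not dividing `h`. [folklore] -/
theorem prime_of_mem_blockPrimesS {h N : ℕ} {ε : ℝ} {k p : ℕ} (hp : p ∈ blockPrimesS h N ε k) :
    p.Prime ∧ ¬p ∣ h :=
  ⟨(mem_blockPrimesS.mp hp).1, (mem_blockPrimesS.mp hp).2.2.2.2⟩

/-- **The congruence count of a block is bilinear**: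
`#{(p, q) ∈ P_k × Q_k : d ∣ |h − p p₂p₃|} = ∑_{m ∈ M_k} ∑_{p ∈ P_k} 1_{mp ≡ h (d)}`.
[cite: Nathanson1996, Thm 10.6 (proof, (10.15))] -/
theorem card_filter_dvd_tripleDist_eqS (h N : ℕ) (ε : ℝ) (k d : ℕ) :
    (#((blockPrimesS h N ε k ×ˢ blockPairsS h N ε k).filter fun t : ℕ × ℕ × ℕ => d ∣ tripleDist h t) : ℕ) =
      ∑ m ∈ blockProductsS h N ε k, ∑ p ∈ blockPrimesS h N ε k,
        if ((m * p : ℕ) : ZMod d) = (h : ZMod d) then 1 else 0 := by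
  classical
  rw [Finset.card_filter, Finset.sum_product]
  -- rewrite the inner sums through `M_k`
  have hinner : ∀ p ∈ blockPrimesS h N ε k,
      ∑ q ∈ blockPairsS h N ε k, (if d ∣ tripleDist h (p, q) then 1 else 0) =
        ∑ m ∈ blockProductsS h N ε k, if ((m * p : ℕ) : ZMod d) = (h : ZMod d) then 1 else 0 := by
    intro p _
    rw [← Finset.card_filter, ← Finset.card_filter]
    have h1 : (blockPairsS h N ε k).filter (fun q : ℕ × ℕ => d ∣ tripleDist h (p, q)) =
        (blockPairsS h N ε k).filter (fun q : ℕ × ℕ =>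
          ((q.1 * q.2 * p : ℕ) : ZMod d) = (h : ZMod d)) := by
      refine Finset.filter_congr fun q _ => ?_
      rw [dvd_tripleDist_iff]
      dsimp only
      rw [show p * q.1 * q.2 = q.1 * q.2 * p by ring]
    rw [h1]
    exact card_filter_blockPairsS_eq h N ε k (fun m => ((m * p : ℕ) : ZMod d) = (h : ZMod d))
  rw [Finset.sum_congr rfl hinner]
  exact Finset.sum_comm

/-- The same count in the shape of `Bilinear.primes_explicit` (indicator coefficients `a = 1_{M_k}`
over `n ∈ [1, M]`, `M_k ⊆ [1, M]`, residue `c = N`). [folklore] -/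
theorem sum_Ioc_indicator_blockProductsS_eq {h N : ℕ} {ε : ℝ} {k M : ℕ}
    (hM : blockProductsS h N ε k ⊆ Finset.Ioc 0 M) (P : ℕ → ℕ → Prop) [∀ n p, Decidable (P n p)] :
    ∑ n ∈ Finset.Ioc 0 M, ∑ p ∈ blockPrimesS h N ε k,
        (if P n p then (if n ∈ blockProductsS h N ε k then (1 : ℂ) else 0) else 0) =
      ((∑ m ∈ blockProductsS h N ε k, ∑ p ∈ blockPrimesS h N ε k, if P m p then 1 else 0 : ℕ) : ℂ) := by
  classical
  push_cast
  have hstep : ∀ n, ∑ p ∈ blockPrimesS h N ε k,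
      (if P n p then (if n ∈ blockProductsS h N ε k then (1 : ℂ) else 0) else 0) =
        if n ∈ blockProductsS h N ε k then ∑ p ∈ blockPrimesS h N ε k, (if P n p then (1 : ℂ) else 0)
          else 0 := by
    intro n
    by_cases hn : n ∈ blockProductsS h N ε k
    · simp only [hn, if_true]
    · simp only [hn, if_false]
      exact Finset.sum_eq_zero fun p _ => by split_ifs <;> rfl
  simp_rw [hstep]
  rw [Finset.sum_ite_mem, Finset.inter_eq_right.mpr hM]

/-- **The remainder of a block against the bilinear discrepancy** (Nathanson p. 294: "We delete some
numbers from the second sum by adding the condition that `(p₁p₂p₃, d) = 1` … This additional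
condition decreases the second term by at most `(1+ε)Nω(d)/(zφ(d))`"): for `d ∣ P(y)` coprime to
`N`,
`|#{t ∈ P_k × Q_k : d ∣ |h − p₁p₂p₃|} − #P_k #M_k/φ(d)|
  ≤ ‖∑_{mp ≡ h} 1_{M_k}(m) − φ(d)⁻¹ ∑_{(mp,d)=1} 1_{M_k}(m)‖ + ω(d) #M_k/φ(d)` (`d` coprime to `h`).
[cite: Nathanson1996, Thm 10.6 (proof, p. 294)] -/
theorem abs_blockRemainderS_le {h N : ℕ} {ε : ℝ} (hN : 0 < N) (hε : 0 < ε) (k : ℕ) {d : ℕ}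
    (hd : d ∣ primesProdBelow (y N)) (hdN : d.Coprime h) {M : ℕ}
    (hM : blockProductsS h N ε k ⊆ Finset.Ioc 0 M) :
    |(#((blockPrimesS h N ε k ×ˢ blockPairsS h N ε k).filter
          fun t : ℕ × ℕ × ℕ => d ∣ tripleDist h t) : ℝ) -
        (#(blockPrimesS h N ε k) : ℝ) * #(blockProductsS h N ε k) / Nat.totient d| ≤
      ‖(∑ n ∈ Finset.Ioc 0 M, ∑ p ∈ blockPrimesS h N ε k,
            if ((n * p : ℕ) : ZMod d) = (resClass h d hdN : (ZMod d)ˣ) then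
              (if n ∈ blockProductsS h N ε k then (1 : ℂ) else 0) else 0) -
          ((Nat.totient d : ℂ))⁻¹ *
            ∑ n ∈ Finset.Ioc 0 M, ∑ p ∈ blockPrimesS h N ε k,
              (if (n * p).Coprime d then (if n ∈ blockProductsS h N ε k then (1 : ℂ) else 0) else 0)‖ +
        (d.primeFactors.card : ℝ) * #(blockProductsS h N ε k) / Nat.totient d := by
  classical
  have hd0 : d ≠ 0 := by
    rintro rfl
    exact primesProdBelow_ne_zero _ (zero_dvd_iff.mp hd)
  have hφ : 0 < (Nat.totient d : ℝ) := by exact_mod_cast Nat.totient_pos.mpr (Nat.pos_of_ne_zero hd0)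
  -- the three integer counts
  set S₁ : ℕ := ∑ m ∈ blockProductsS h N ε k, ∑ p ∈ blockPrimesS h N ε k, if ((m * p : ℕ) : ZMod d) = (h : ZMod d) then 1 else 0 with hS₁
  set S₂ : ℕ := ∑ m ∈ blockProductsS h N ε k, ∑ p ∈ blockPrimesS h N ε k, if (m * p).Coprime d then 1 else 0 with hS₂
  set S₃ : ℕ := ∑ m ∈ blockProductsS h N ε k, ∑ p ∈ blockPrimesS h N ε k, if ¬(m * p).Coprime d then 1 else 0 with hS₃
  have hcount : (#((blockPrimesS h N ε k ×ˢ blockPairsS h N ε k).filter fun t : ℕ × ℕ × ℕ => d ∣ tripleDist h t) : ℕ) =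
      S₁ := card_filter_dvd_tripleDist_eqS h N ε k d
  have h23 : S₂ + S₃ = #(blockPrimesS h N ε k) * #(blockProductsS h N ε k) := by
    rw [hS₂, hS₃, ← Finset.sum_add_distrib]
    have : ∀ m ∈ blockProductsS h N ε k, (∑ p ∈ blockPrimesS h N ε k, (if (m * p).Coprime d then 1 else 0) +
        ∑ p ∈ blockPrimesS h N ε k, if ¬(m * p).Coprime d then 1 else 0) = #(blockPrimesS h N ε k) := by
      intro m _
      rw [← Finset.sum_add_distrib]
      calc ∑ p ∈ blockPrimesS h N ε k, ((if (m * p).Coprime d then 1 else 0) + if ¬(m * p).Coprime d then 1 else 0)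
          = ∑ _p ∈ blockPrimesS h N ε k, 1 := Finset.sum_congr rfl fun p _ => by split_ifs <;> simp
        _ = #(blockPrimesS h N ε k) := by simp
    rw [Finset.sum_congr rfl this, Finset.sum_const, smul_eq_mul, mul_comm]
  -- `S₃ ≤ ω(d) #(blockProductsS h N ε k)`
  have h3 : S₃ ≤ d.primeFactors.card * #(blockProductsS h N ε k) := by
    rw [hS₃]
    calc ∑ m ∈ blockProductsS h N ε k, ∑ p ∈ blockPrimesS h N ε k, (if ¬(m * p).Coprime d then 1 else 0)
        ≤ ∑ _m ∈ blockProductsS h N ε k, d.primeFactors.card := by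
          refine Finset.sum_le_sum fun m hm => ?_
          obtain ⟨-, -, -, hcopd⟩ := blockProductsS_props hN hε hm
          have hmd : m.Coprime d := hcopd d hd
          rw [← Finset.card_filter]
          refine Finset.card_le_card_of_injOn (fun p => p) (fun p hp => ?_) (Set.injOn_id _)
          rw [Finset.mem_coe, Finset.mem_filter] at hp
          obtain ⟨hpP, hncop⟩ := hp
          have hpprime := (prime_of_mem_blockPrimesS hpP).1
          rw [Nat.coprime_mul_iff_left, not_and_or] at hncop
          rcases hncop with hnc | hnc
          · exact absurd hmd hnc
          · rw [Finset.mem_coe, Nat.mem_primeFactors]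
            exact ⟨hpprime, (Nat.Prime.dvd_iff_not_coprime hpprime).mpr hnc, hd0⟩
      _ = d.primeFactors.card * #(blockProductsS h N ε k) := by rw [Finset.sum_const, smul_eq_mul, mul_comm]
  -- the bilinear expression equals `S₁ - S₂/φ(d)`
  have hE : (∑ n ∈ Finset.Ioc 0 M, ∑ p ∈ blockPrimesS h N ε k,
        if ((n * p : ℕ) : ZMod d) = (resClass h d hdN : (ZMod d)ˣ) then
          (if n ∈ blockProductsS h N ε k then (1 : ℂ) else 0) else 0) -
      ((Nat.totient d : ℂ))⁻¹ *
        ∑ n ∈ Finset.Ioc 0 M, ∑ p ∈ blockPrimesS h N ε k,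
          (if (n * p).Coprime d then (if n ∈ blockProductsS h N ε k then (1 : ℂ) else 0) else 0) =
      ((S₁ : ℝ) - (S₂ : ℝ) / Nat.totient d : ℝ) := by
    rw [coe_resClass, sum_Ioc_indicator_blockProductsS_eq hM, sum_Ioc_indicator_blockProductsS_eq hM,
      hS₁, hS₂]
    push_cast
    simp only [apply_ite Complex.ofReal, Complex.ofReal_one, Complex.ofReal_zero]
    ring
  rw [hE, Complex.norm_real, Real.norm_eq_abs, hcount]
  -- `|S₁ - #(blockPrimesS h N ε k) #(blockProductsS h N ε k)/φ| ≤ |S₁ - S₂/φ| + S₃/φ`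
  have hkey : (S₁ : ℝ) - (#(blockPrimesS h N ε k) : ℝ) * #(blockProductsS h N ε k) / Nat.totient d =
      ((S₁ : ℝ) - (S₂ : ℝ) / Nat.totient d) - (S₃ : ℝ) / Nat.totient d := by
    have : ((#(blockPrimesS h N ε k) : ℝ)) * #(blockProductsS h N ε k) = (S₂ : ℝ) + S₃ := by exact_mod_cast h23.symm
    rw [this]; ring
  rw [hkey]
  have hS₃ : (S₃ : ℝ) / Nat.totient d ≤ (d.primeFactors.card : ℝ) * #(blockProductsS h N ε k) / Nat.totient d :=
    div_le_div_of_nonneg_right (by exact_mod_cast h3) hφ.le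
  have hS₃0 : 0 ≤ (S₃ : ℝ) / Nat.totient d := by positivity
  calc |((S₁ : ℝ) - (S₂ : ℝ) / Nat.totient d) - (S₃ : ℝ) / Nat.totient d|
      ≤ |(S₁ : ℝ) - (S₂ : ℝ) / Nat.totient d| + |(S₃ : ℝ) / Nat.totient d| := abs_sub _ _
    _ ≤ _ := by rw [abs_of_nonneg hS₃0]; exact add_le_add le_rfl hS₃

/-- For `d ∣ P(y)` NOT coprime to `h` the block count vanishes: a prime `q ∣ (d, h)` dividing
`h − p₁p₂p₃` would divide `p₁p₂p₃`, but `q < y ≤ p₂ ≤ p₃` and `p₁ ∤ h`. [folklore] -/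
theorem card_filter_dvd_tripleDist_eq_zeroS {h N : ℕ} {ε : ℝ} (k : ℕ) {d : ℕ}
    (hd : d ∣ primesProdBelow (y N)) (hdN : ¬d.Coprime h) :
    #((blockPrimesS h N ε k ×ˢ blockPairsS h N ε k).filter
        fun t : ℕ × ℕ × ℕ => d ∣ tripleDist h t) = 0 := by
  rw [Finset.card_eq_zero, Finset.filter_eq_empty_iff]
  intro t ht hdt
  rw [Finset.mem_product] at ht
  obtain ⟨hp₁, hndvd⟩ := prime_of_mem_blockPrimesS ht.1
  obtain ⟨-, h₂, h₃, hy2, h23, -, -⟩ := mem_blockPairsS.mp ht.2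
  -- a prime `q ∣ gcd(d, h)`
  obtain ⟨q, hq, hqg⟩ := Nat.exists_prime_and_dvd (show Nat.gcd d h ≠ 1 from hdN)
  have hqd : q ∣ d := hqg.trans (Nat.gcd_dvd_left d h)
  have hqN : q ∣ h := hqg.trans (Nat.gcd_dvd_right d h)
  have hqy : (q : ℝ) < y N := by
    have hqP : q ∣ primesProdBelow (y N) := hqd.trans hd
    rwa [dvd_primesProdBelow_iff hq] at hqP
  -- `q ∣ h - p₁p₂p₃`, hence `q ∣ p₁p₂p₃`
  have hqdist : (q : ℤ) ∣ (h : ℤ) - t.1 * t.2.1 * t.2.2 := by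
    have : q ∣ tripleDist h t := hqd.trans hdt
    unfold tripleDist at this
    rwa [← Int.natCast_dvd_natCast, Int.natCast_natAbs, dvd_abs] at this
  have hqP : q ∣ t.1 * t.2.1 * t.2.2 := by
    have h1 : (q : ℤ) ∣ (t.1 * t.2.1 * t.2.2 : ℕ) := by
      have := dvd_sub (Int.natCast_dvd_natCast.mpr hqN) hqdist
      push_cast at this ⊢
      simpa using this
    exact Int.natCast_dvd_natCast.mp h1
  rcases (Nat.Prime.dvd_mul hq).mp hqP with h12 | h3'
  · rcases (Nat.Prime.dvd_mul hq).mp h12 with h1' | h2'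
    · exact hndvd ((Nat.prime_dvd_prime_iff_eq hq hp₁).mp h1' ▸ hqN)
    · have := (Nat.prime_dvd_prime_iff_eq hq h₂).mp h2'
      rw [this] at hqy
      linarith
  · have := (Nat.prime_dvd_prime_iff_eq hq h₃).mp h3'
    have hy3 : y N ≤ (t.2.2 : ℝ) := hy2.trans (by exact_mod_cast h23)
    rw [this] at hqy
    linarith


/-! ### Summing over the moduli `d` and over the blocks -/

open scoped Classical in
/-- **The remainder of one block** ((10.15) for `B^{(ℓ)}`): for `D ≥ 0`,
`∑_{d < ⌈D⌉, d ∣ P(y)} |#{t ∈ P_k × Q_k : d ∣ |h − p₁p₂p₃|} − g(d) #P_k #Q_k|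
  ≤ ∑_{d ≤ ⌈D⌉} max_c ‖E_k(d, c)‖ + ∑_{d ≤ ⌈D⌉} ω(d) #M_k/φ(d)`,
with `E_k` the bilinear discrepancy of `Bilinear.primes_explicit` for `a = 1_{M_k}`.
[cite: Nathanson1996, Thm 10.6 (proof, (10.15))] -/
theorem blockRemainderS_sum_le {h N : ℕ} {ε : ℝ} (hN : 0 < N) (hε : 0 < ε) (k : ℕ) (D : ℝ) {M : ℕ}
    (hM : blockProductsS h N ε k ⊆ Finset.Ioc 0 M) :
    ∑ d ∈ (Finset.range ⌈D⌉₊).filter (· ∣ primesProdBelow (y N)),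
        |(#((blockPrimesS h N ε k ×ˢ blockPairsS h N ε k).filter
            fun t : ℕ × ℕ × ℕ => d ∣ tripleDist h t) : ℝ) -
          shiftedPrimesDensity h d * #(blockPrimesS h N ε k ×ˢ blockPairsS h N ε k)| ≤
      ∑ d ∈ Finset.Icc 1 ⌈D⌉₊, (⨆ c : (ZMod d)ˣ,
        ‖(∑ n ∈ Finset.Ioc 0 M, ∑ p ∈ blockPrimesS h N ε k,
            if ((n * p : ℕ) : ZMod d) = c then
              (if n ∈ blockProductsS h N ε k then (1 : ℂ) else 0) else 0) -
          ((Nat.totient d : ℂ))⁻¹ *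
            ∑ n ∈ Finset.Ioc 0 M, ∑ p ∈ blockPrimesS h N ε k,
              (if (n * p).Coprime d then (if n ∈ blockProductsS h N ε k then (1 : ℂ) else 0) else 0)‖) +
      ∑ d ∈ Finset.Icc 1 ⌈D⌉₊,
        (d.primeFactors.card : ℝ) * #(blockProductsS h N ε k) / Nat.totient d := by
  rw [← Finset.sum_add_distrib]
  have hsub : (Finset.range ⌈D⌉₊).filter (· ∣ primesProdBelow (y N)) ⊆ Finset.Icc 1 ⌈D⌉₊ := by
    intro d hd
    rw [Finset.mem_filter, Finset.mem_range] at hd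
    rw [Finset.mem_Icc]
    refine ⟨Nat.one_le_iff_ne_zero.mpr ?_, hd.1.le⟩
    rintro rfl
    exact primesProdBelow_ne_zero _ (zero_dvd_iff.mp hd.2)
  have hnonneg : ∀ d ∈ Finset.Icc 1 ⌈D⌉₊, 0 ≤ (⨆ c : (ZMod d)ˣ,
        ‖(∑ n ∈ Finset.Ioc 0 M, ∑ p ∈ blockPrimesS h N ε k,
            if ((n * p : ℕ) : ZMod d) = c then
              (if n ∈ blockProductsS h N ε k then (1 : ℂ) else 0) else 0) -
          ((Nat.totient d : ℂ))⁻¹ *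
            ∑ n ∈ Finset.Ioc 0 M, ∑ p ∈ blockPrimesS h N ε k,
              (if (n * p).Coprime d then (if n ∈ blockProductsS h N ε k then (1 : ℂ) else 0) else 0)‖) +
      (d.primeFactors.card : ℝ) * #(blockProductsS h N ε k) / Nat.totient d := by
    intro d _
    refine add_nonneg (Real.iSup_nonneg fun c : (ZMod d)ˣ => norm_nonneg _) (by positivity)
  refine le_trans (Finset.sum_le_sum fun d hd => ?_)
    (Finset.sum_le_sum_of_subset_of_nonneg hsub fun d hd _ => hnonneg d hd)
  -- one modulus `d ∣ P(y)`, `1 ≤ d`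
  have hdP : d ∣ primesProdBelow (y N) := (Finset.mem_filter.mp hd).2
  have hd1 : 1 ≤ d := (Finset.mem_Icc.mp (hsub hd)).1
  have hd0 : d ≠ 0 := by omega
  rw [Finset.card_product, Nat.cast_mul, ← card_blockProductsS]
  by_cases hdN : d.Coprime h
  · -- coprime modulus: the bilinear discrepancy at the class of `h`
    have hg : shiftedPrimesDensity h d = ((Nat.totient d : ℝ))⁻¹ := by
      rw [shiftedPrimesDensity_apply, if_pos ⟨hdN, hd0⟩]
    rw [hg, show ((Nat.totient d : ℝ))⁻¹ * ((#(blockPrimesS h N ε k) : ℝ) * #(blockProductsS h N ε k)) =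
      (#(blockPrimesS h N ε k) : ℝ) * #(blockProductsS h N ε k) / Nat.totient d by ring]
    refine (abs_blockRemainderS_le hN hε k hdP hdN hM).trans (add_le_add ?_ le_rfl)
    exact le_ciSup (f := fun c : (ZMod d)ˣ =>
      ‖(∑ n ∈ Finset.Ioc 0 M, ∑ p ∈ blockPrimesS h N ε k,
          if ((n * p : ℕ) : ZMod d) = c then
            (if n ∈ blockProductsS h N ε k then (1 : ℂ) else 0) else 0) -
        ((Nat.totient d : ℂ))⁻¹ *
          ∑ n ∈ Finset.Ioc 0 M, ∑ p ∈ blockPrimesS h N ε k,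
            (if (n * p).Coprime d then (if n ∈ blockProductsS h N ε k then (1 : ℂ) else 0) else 0)‖)
      (Set.finite_range _).bddAbove (resClass h d hdN)
  · -- modulus not coprime to `h`: the count and the density both vanish
    have hg : shiftedPrimesDensity h d = 0 := by
      rw [shiftedPrimesDensity_apply, if_neg (fun hc => hdN hc.1)]
    rw [hg, card_filter_dvd_tripleDist_eq_zeroS k hdP hdN]
    simp only [Nat.cast_zero, zero_mul, sub_zero, abs_zero]
    exact hnonneg d (hsub hd)


/-- **`R_S(h, N, ε, D) ≤ ∑_k R^{(k)}`** (Nathanson: `|B̃| = ∑_ℓ |B^{(ℓ)}|` and `R ≤ ∑_ℓ R^{(ℓ)}`): splitting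
`T̃` into its blocks `T_k = P_k × Q_k`, `0 ≤ k ≤ K(N, ε)`. [cite: Nathanson1996, Thm 10.6 (proof, p. 288)] -/
theorem switchedRemainderS_le_sum_blocks {h N : ℕ} {ε : ℝ} (hN : 2 ≤ N) (hε : 0 < ε) (D : ℝ) :
    switchedRemainderS h N ε D ≤
      ∑ k ∈ Finset.range (maxGridIndexT N ε + 1),
        ∑ d ∈ (Finset.range ⌈D⌉₊).filter (· ∣ primesProdBelow (y N)),
          |(#((blockPrimesS h N ε k ×ˢ blockPairsS h N ε k).filter
              fun t : ℕ × ℕ × ℕ => d ∣ tripleDist h t) : ℝ) -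
            shiftedPrimesDensity h d * #(blockPrimesS h N ε k ×ˢ blockPairsS h N ε k)| := by
  classical
  have hNpos : 0 < N := by omega
  rw [Finset.sum_comm]
  unfold switchedRemainderS
  refine Finset.sum_le_sum fun d _ => ?_
  -- fibres of the block label
  set T := switchedTriplesS h N ε with hT
  set f : ℕ × ℕ × ℕ → ℕ := fun t => chenGridIndexT N ε t.1 with hf
  have hmaps : ∀ S : Finset (ℕ × ℕ × ℕ), S ⊆ T →
      (S : Set (ℕ × ℕ × ℕ)).MapsTo f (Finset.range (maxGridIndexT N ε + 1) : Finset ℕ) := by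
    intro S hS t ht
    have ht' := mem_switchedTriplesS.mp (hS (Finset.mem_coe.mp ht))
    rw [Finset.mem_coe, Finset.mem_range, Nat.lt_succ_iff]
    exact chenGridIndexT_le_maxGridIndexT hNpos hε ht'.2.2.2.2.1 ht'.2.2.2.2.2.1
  have hblock : ∀ k, T.filter (fun t => f t = k) = blockPrimesS h N ε k ×ˢ blockPairsS h N ε k := fun k =>
    switchedTriplesS_filter_eq hN hε k
  -- the two counts are sums over the blocks
  have h1 : (#(T.filter fun t : ℕ × ℕ × ℕ => d ∣ tripleDist h t) : ℝ) =
      ∑ k ∈ Finset.range (maxGridIndexT N ε + 1),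
        (#((blockPrimesS h N ε k ×ˢ blockPairsS h N ε k).filter
          fun t : ℕ × ℕ × ℕ => d ∣ tripleDist h t) : ℝ) := by
    rw [Finset.card_eq_sum_card_fiberwise (hmaps _ (Finset.filter_subset _ _)), Nat.cast_sum]
    refine Finset.sum_congr rfl fun k _ => ?_
    rw [Finset.filter_filter, ← hblock k, Finset.filter_filter]
    congr 2
    exact Finset.filter_congr fun t _ => and_comm
  have h2 : (#T : ℝ) = ∑ k ∈ Finset.range (maxGridIndexT N ε + 1),
      (#(blockPrimesS h N ε k ×ˢ blockPairsS h N ε k) : ℝ) := by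
    rw [Finset.card_eq_sum_card_fiberwise (hmaps T le_rfl), Nat.cast_sum]
    exact Finset.sum_congr rfl fun k _ => by rw [hblock k]
  rw [h1, h2, Finset.mul_sum, ← Finset.sum_sub_distrib]
  exact Finset.abs_sum_le_sum_abs _ _


set_option maxHeartbeats 1600000 in
open scoped Classical in
/-- **The estimate for one block** (Nathanson (10.15): `R^{(ℓ)} ≪ N/(log N)⁴`), for the grid started
at `N^{1/10}`: with `L' = (4/5) log N` (so that `log Y ≥ L'/8` for every block level `ℓ ≥ N^{1/10}`),
for `0 < ε ≤ 1`, `0 < δ ≤ 1/4`, `N ≥ 9^{10}` with `L' ≥ 32`, `L'¹⁸ ≤ N^{1/20}`, `128 L'⁶ ≤ N^δ`, and every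
block `k ≤ K(N, ε)` (blocks with the modulus `h ≠ 0`, `h ≤ N`, so that `log K = log h ≤ log N` in
`Bilinear.primes_explicit` with `K = h`), the bilinear discrepancy sum for the block plus the
correction `∑_d ω(d) #M_k/φ(d)` is at most `(4·10⁹ + 3·10⁸ C₂ + 1) N/L'⁴`.
[cite: Nathanson1996, Thm 10.6 (proof, (10.15), p. 295)] -/
theorem blockTotal_leS {C₂ : ℝ} (hC₂0 : 0 ≤ C₂) (hSW : SWBound ((20 : ℕ) : ℝ) C₂) {ε δ : ℝ}
    (hε : 0 < ε) (hε1 : ε ≤ 1) (hδ : 0 < δ) (hδ1 : δ ≤ 1 / 4) {h N : ℕ} (hh0 : h ≠ 0) (hhN : h ≤ N)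
    (hN : 9 ^ 10 ≤ N)
    (hL : 32 ≤ 4 / 5 * Real.log N) (hev1 : (4 / 5 * Real.log N) ^ 18 ≤ (N : ℝ) ^ (1 / 20 : ℝ))
    (hev2 : 128 * (4 / 5 * Real.log N) ^ 6 ≤ (N : ℝ) ^ δ) {k : ℕ} (hk : k ≤ maxGridIndexT N ε) :
    (∑ d ∈ Finset.Icc 1 ⌈(N : ℝ) ^ (1 / 2 - δ)⌉₊, (⨆ c : (ZMod d)ˣ,
        ‖(∑ n ∈ Finset.Ioc 0 ⌈(N : ℝ) / gridLevelT N ε k⌉₊, ∑ p ∈ blockPrimesS h N ε k,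
            if ((n * p : ℕ) : ZMod d) = c then
              (if n ∈ blockProductsS h N ε k then (1 : ℂ) else 0) else 0) -
          ((Nat.totient d : ℂ))⁻¹ *
            ∑ n ∈ Finset.Ioc 0 ⌈(N : ℝ) / gridLevelT N ε k⌉₊, ∑ p ∈ blockPrimesS h N ε k,
              (if (n * p).Coprime d then
                (if n ∈ blockProductsS h N ε k then (1 : ℂ) else 0) else 0)‖)) +
      ∑ d ∈ Finset.Icc 1 ⌈(N : ℝ) ^ (1 / 2 - δ)⌉₊,
        (d.primeFactors.card : ℝ) * #(blockProductsS h N ε k) / Nat.totient d ≤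
      (4 * 10 ^ 9 + 3 * 10 ^ 8 * C₂ + 1) * N / (4 / 5 * Real.log N) ^ 4 := by
  -- basic quantities
  have hN2 : 2 ≤ N := le_trans (by norm_num) hN
  have hNpos : 0 < N := by omega
  have hN0 : (0 : ℝ) < N := by exact_mod_cast hNpos
  have hN1 : (1 : ℝ) ≤ N := by exact_mod_cast (show 1 ≤ N by omega)
  have hN1' : (1 : ℝ) < N := by exact_mod_cast (show 1 < N by omega)
  set L : ℝ := 4 / 5 * Real.log N with hLdef
  set LN : ℝ := Real.log N with hLNdef
  have hL0 : 0 < L := by linarith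
  have hLN0 : 0 < LN := by linarith
  have hL1 : 1 ≤ L := by linarith
  set ℓ : ℝ := gridLevelT N ε k with hℓdef
  obtain ⟨hℓ0, hzℓ⟩ := gridLevelT_pos hNpos hε k
  have hz9 : (9 : ℝ) ≤ (N : ℝ) ^ (1 / 10 : ℝ) := by
    rw [show (9 : ℝ) = ((9 : ℝ) ^ (10 : ℕ)) ^ (1 / 10 : ℝ) by
      rw [← Real.rpow_natCast, ← Real.rpow_mul (by norm_num)]; norm_num]
    exact Real.rpow_le_rpow (by norm_num) (by exact_mod_cast hN) (by norm_num)
  have hℓ9 : 9 ≤ ℓ := hz9.trans hzℓ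
  have hℓ1 : 1 ≤ ℓ := by linarith
  have hℓlo : (N : ℝ) ^ (1 / 10 : ℝ) ≤ ℓ := hzℓ
  have hℓy : ℓ ≤ y N := gridLevelT_le_y hN2 hε hk
  have hℓhi : ℓ ≤ (N : ℝ) ^ (1 / 3 : ℝ) := hℓy
  have hyN : y N ≤ N := by
    have := Real.rpow_le_rpow_of_exponent_le hN1 (show (1 / 3 : ℝ) ≤ 1 by norm_num)
    rwa [Real.rpow_one] at this
  have hℓN : ℓ ≤ N := hℓy.trans hyN
  have hℓsqN : ℓ ≤ Real.sqrt N := by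
    rw [Real.sqrt_eq_rpow]
    exact hℓhi.trans (Real.rpow_le_rpow_of_exponent_le hN1 (by norm_num))
  have hsqrtℓ : (N : ℝ) ^ (1 / 20 : ℝ) ≤ Real.sqrt ℓ := by
    rw [show (1 / 20 : ℝ) = 1 / 10 * (1 / 2) by norm_num, Real.rpow_mul hN0.le,
      Real.sqrt_eq_rpow]
    exact Real.rpow_le_rpow (Real.rpow_nonneg hN0.le _) hℓlo (by norm_num)
  have hL18 : L ^ 18 ≤ Real.sqrt ℓ := hev1.trans hsqrtℓ
  have hlogz : Real.log ((N : ℝ) ^ (1 / 10 : ℝ)) = 1 / 10 * LN := Real.log_rpow hN0 _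
  -- `4/5 LN ≥ LN/2 + 1` (used for `log(Y+1)`, `log Dc`, `W`)
  have hLhalf : LN / 2 + 1 ≤ L := by rw [hLdef]; linarith
  -- `Y`, `TY`, `M`, `D`, `D₀`
  set Y : ℝ := min (y N) ((1 + ε) * ℓ) with hYdef
  have hℓY : ℓ ≤ Y := le_min hℓy (by nlinarith)
  have hY9 : 9 ≤ Y := hℓ9.trans hℓY
  have hYℓ : Y ≤ 2 * ℓ := (min_le_right _ _).trans (by nlinarith)
  have hY0 : 0 < Y := by linarith
  have hlogY : L / 8 ≤ Real.log Y := by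
    have := Real.log_le_log (by linarith) (hzℓ.trans hℓY)
    rw [hlogz] at this
    rw [hLdef]; linarith
  have h4N : (4 : ℝ) ≤ N := by exact_mod_cast le_trans (by norm_num) hN
  have hs2 : 2 ≤ Real.sqrt N := by
    calc (2 : ℝ) = Real.sqrt 4 := by
          rw [show (4 : ℝ) = 2 ^ 2 by norm_num, Real.sqrt_sq (by norm_num)]
      _ ≤ Real.sqrt N := Real.sqrt_le_sqrt h4N
  have hsN : Real.sqrt N * Real.sqrt N = N := Real.mul_self_sqrt hN0.le
  have hlogsqrt : Real.log (2 * Real.sqrt N) ≤ L := by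
    rw [Real.log_mul (by norm_num) (by linarith), Real.sqrt_eq_rpow, Real.log_rpow hN0]
    have hl2 := Real.log_two_lt_d9
    norm_num at hl2
    linarith
  have hYN : Y + 1 ≤ 2 * Real.sqrt N := by
    have h1 : Y ≤ y N := min_le_left _ _
    have h2 : y N ≤ Real.sqrt N := by
      rw [Real.sqrt_eq_rpow]
      exact Real.rpow_le_rpow_of_exponent_le hN1 (by norm_num)
    linarith
  have hYN' : Y + 1 ≤ N := by
    calc Y + 1 ≤ 2 * Real.sqrt N := hYN
      _ ≤ Real.sqrt N * Real.sqrt N := mul_le_mul_of_nonneg_right hs2 (Real.sqrt_nonneg N)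
      _ = N := hsN
  have hlogY1 : Real.log (Y + 1) ≤ L := (Real.log_le_log (by linarith) hYN).trans hlogsqrt
  set TY : ℕ := ⌈Y⌉₊ with hTYdef
  have hTY : (TY : ℝ) ≤ Y + 1 := (Nat.ceil_lt_add_one hY0.le).le
  set T : ℝ := ((TY - 1 : ℕ) : ℝ) with hTdef
  have hT0 : 0 ≤ T := Nat.cast_nonneg _
  have hT : T ≤ 2 * ℓ := by
    have : T ≤ Y := by
      rw [hTdef]
      rcases Nat.eq_zero_or_pos TY with h0 | hpos
      · rw [h0]; simp; linarith
      · rw [Nat.cast_sub hpos, Nat.cast_one]; linarith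
    exact this.trans hYℓ
  set M : ℕ := ⌈(N : ℝ) / ℓ⌉₊ with hMdef
  have hNℓ1 : 1 ≤ (N : ℝ) / ℓ := (one_le_div hℓ0).mpr hℓN
  have hM : (M : ℝ) ≤ 2 * N / ℓ := by
    have := (Nat.ceil_lt_add_one (by positivity : (0 : ℝ) ≤ N / ℓ)).le
    calc (M : ℝ) ≤ N / ℓ + 1 := this
      _ ≤ N / ℓ + N / ℓ := by linarith
      _ = 2 * N / ℓ := by ring
  have hM0 : (0 : ℝ) ≤ M := Nat.cast_nonneg _
  set Dc : ℕ := ⌈(N : ℝ) ^ (1 / 2 - δ)⌉₊ with hDcdef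
  have hNδ1 : (1 : ℝ) ≤ (N : ℝ) ^ (1 / 2 - δ) := Real.one_le_rpow hN1 (by linarith)
  have hDc1 : (1 : ℝ) ≤ Dc := by
    have : 1 ≤ Dc := Nat.one_le_iff_ne_zero.mpr (Nat.pos_iff_ne_zero.mp
      (Nat.ceil_pos.mpr (by linarith)))
    exact_mod_cast this
  have hDc : (Dc : ℝ) ≤ 2 * (N : ℝ) ^ (1 / 2 - δ) := by
    have := (Nat.ceil_lt_add_one (by linarith : (0 : ℝ) ≤ (N : ℝ) ^ (1 / 2 - δ))).le
    linarith
  have hlogDc : Real.log Dc ≤ L := by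
    have hsq : (N : ℝ) ^ (1 / 2 - δ) ≤ Real.sqrt N := by
      rw [Real.sqrt_eq_rpow]
      exact Real.rpow_le_rpow_of_exponent_le hN1 (by linarith)
    exact (Real.log_le_log (by linarith) (by linarith)).trans hlogsqrt
  set D₀ : ℕ := ⌊(L / 16) ^ 6⌋₊ with hD₀def
  have hL16 : 2 ≤ L / 16 := by rw [le_div_iff₀ (by norm_num)]; linarith
  have hpow6 : (2 : ℝ) ^ 6 ≤ (L / 16) ^ 6 := pow_le_pow_left₀ (by norm_num) hL16 6
  have hD₀hi : (D₀ : ℝ) ≤ (L / 16) ^ 6 := Nat.floor_le (by positivity)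
  have hD₀lo : (L / 16) ^ 6 / 2 ≤ D₀ := by
    have := (Nat.sub_one_lt_floor ((L / 16) ^ 6)).le
    have h64 : (64 : ℝ) ≤ (L / 16) ^ 6 := le_trans (by norm_num) hpow6
    linarith
  have hD₀1 : 1 ≤ D₀ := by
    have : (1 : ℝ) ≤ D₀ := by
      have h64 : (64 : ℝ) ≤ (L / 16) ^ 6 := le_trans (by norm_num) hpow6
      linarith
    exact_mod_cast this
  have hD₀Y : (D₀ : ℝ) ≤ (Real.log Y / 2) ^ ((20 : ℕ) : ℝ) := by
    rw [Real.rpow_natCast]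
    have h1 : L / 16 ≤ Real.log Y / 2 := by linarith
    have h1' : 1 ≤ L / 16 := by linarith
    calc (D₀ : ℝ) ≤ (L / 16) ^ 6 := hD₀hi
      _ ≤ (L / 16) ^ 20 := pow_le_pow_right₀ h1' (by norm_num)
      _ ≤ (Real.log Y / 2) ^ 20 := pow_le_pow_left₀ (by positivity) h1 20
  set W : ℝ := totientInvSum Dc with hWdef
  have hW0 : 0 ≤ W := totientInvSum_nonneg Dc
  have hW : W ≤ 4 * L ^ 2 := by
    calc W ≤ (1 + Real.log Dc) ^ 2 := totientInvSum_le Dc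
      _ ≤ (2 * L) ^ 2 := by
          have : 0 ≤ 1 + Real.log Dc := by
            have := Real.log_nonneg hDc1; linarith
          exact pow_le_pow_left₀ this (by linarith) 2
      _ = 4 * L ^ 2 := by ring
  -- the indicator coefficients
  set a : ℕ → ℂ := fun n => if n ∈ blockProductsS h N ε k then 1 else 0 with hadef
  have ha : ∀ n, ‖a n‖ ≤ 1 := fun n => by
    simp only [hadef]; split_ifs <;> simp
  -- Theorem 10.7 for the block
  have hB := Bilinear.primes_explicit (by norm_num : (0 : ℝ) < ((20 : ℕ) : ℝ)) hC₂0 hSW a ha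
    hh0 M ⌈ℓ⌉₊ TY Dc hD₀1 hY9 hTY hD₀Y
  simp only [Real.rpow_natCast] at hB
  rw [← hTdef, ← hWdef] at hB
  -- the arithmetic (with `L = (4/5) log N`, and `log h ≤ log N ≤ 2L` in the `log K/log 2` slot)
  have hlogh : Real.log h ≤ 2 * L := by
    have h1 : Real.log h ≤ Real.log N :=
      Real.log_le_log (by exact_mod_cast Nat.pos_of_ne_zero hh0) (by exact_mod_cast hhN)
    rw [hLdef]; linarith
  have harith := blockBound_arithT (L := L) (LN := Real.log h) (N := (N : ℝ)) (ℓ := ℓ) (Y := Y)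
    (M := (M : ℝ)) (T := T) (D := (Dc : ℝ)) (D₀ := (D₀ : ℝ)) (W := W) (C₂ := C₂) (δ := δ)
    hL hN1 hℓ1 hL18 hℓsqN hℓN hM0 hM hT0 hT hY9 hYℓ hlogY hlogY1 hDc1 hDc hlogDc hD₀lo hD₀hi hW0 hW
    hC₂0 hev2 hlogh
  -- the correction term `∑ ω(d) #M_k/φ(d) ≤ 16 L³ N/ℓ ≤ N/L⁴`
  have hcard : (#(blockProductsS h N ε k) : ℝ) ≤ M := by
    have hsub : blockProductsS h N ε k ⊆ Finset.Ioc 0 M := by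
      intro m hm
      obtain ⟨hm1, hmlt, -, -⟩ := blockProductsS_props hNpos hε hm
      rw [Finset.mem_Ioc]
      refine ⟨hm1, ?_⟩
      have : m < M := Nat.lt_ceil.mpr hmlt
      omega
    calc (#(blockProductsS h N ε k) : ℝ) ≤ #(Finset.Ioc 0 M) := by exact_mod_cast Finset.card_le_card hsub
      _ = M := by simp
  have hcorr : ∑ d ∈ Finset.Icc 1 Dc,
      (d.primeFactors.card : ℝ) * #(blockProductsS h N ε k) / Nat.totient d ≤ N / L ^ 4 := by
    have hstep : ∀ d ∈ Finset.Icc 1 Dc,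
        (d.primeFactors.card : ℝ) * #(blockProductsS h N ε k) / Nat.totient d ≤
          (L / Real.log 2 * M) * ((Nat.totient d : ℝ))⁻¹ := by
      intro d hd
      obtain ⟨hd1, hdD⟩ := Finset.mem_Icc.mp hd
      have hφ : 0 < (Nat.totient d : ℝ) := by exact_mod_cast Nat.totient_pos.mpr hd1
      rw [div_eq_mul_inv]
      refine mul_le_mul_of_nonneg_right ?_ (inv_nonneg.mpr hφ.le)
      have hω : (d.primeFactors.card : ℝ) ≤ L / Real.log 2 := by
        refine (card_primeFactors_le_log_div (show d ≠ 0 by omega)).trans ?_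
        refine div_le_div_of_nonneg_right ?_ (Real.log_pos one_lt_two).le
        exact (Real.log_le_log (by exact_mod_cast hd1) (by exact_mod_cast hdD)).trans hlogDc
      exact mul_le_mul hω hcard (Nat.cast_nonneg _)
        (div_nonneg hL0.le (Real.log_pos one_lt_two).le)
    refine (Finset.sum_le_sum hstep).trans ?_
    rw [← Finset.mul_sum, ← totientInvSum]
    have hl2 : L / Real.log 2 ≤ 2 * L := by
      calc L / Real.log 2 = L * (1 / Real.log 2) := by ring
        _ ≤ L * 2 := mul_le_mul_of_nonneg_left inv_log_two_le_two hL0.le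
        _ = 2 * L := by ring
    have hℓbig : 16 * L ^ 7 ≤ ℓ := by
      have hsqℓ_le : Real.sqrt ℓ ≤ ℓ := by
        have h1 : 1 ≤ Real.sqrt ℓ := by
          have := Real.sqrt_le_sqrt hℓ1
          rwa [Real.sqrt_one] at this
        calc Real.sqrt ℓ = Real.sqrt ℓ * 1 := by ring
          _ ≤ Real.sqrt ℓ * Real.sqrt ℓ := mul_le_mul_of_nonneg_left h1 (Real.sqrt_nonneg ℓ)
          _ = ℓ := Real.mul_self_sqrt hℓ0.le
      have h32 : (32 : ℝ) ^ 11 ≤ L ^ 11 := pow_le_pow_left₀ (by norm_num) hL 11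
      calc 16 * L ^ 7 ≤ L ^ 11 * L ^ 7 := by
            refine mul_le_mul_of_nonneg_right (le_trans (by norm_num) h32) (by positivity)
        _ = L ^ 18 := by ring
        _ ≤ Real.sqrt ℓ := hL18
        _ ≤ ℓ := hsqℓ_le
    calc L / Real.log 2 * M * totientInvSum Dc ≤ (2 * L) * (2 * N / ℓ) * (4 * L ^ 2) := by
          refine mul_le_mul (mul_le_mul hl2 hM hM0 (by positivity)) hW hW0 (by positivity)
      _ = 16 * L ^ 3 * N / ℓ := by ring
      _ ≤ N / L ^ 4 := by
          rw [div_le_div_iff₀ hℓ0 (by positivity)]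
          calc 16 * L ^ 3 * N * L ^ 4 = (16 * L ^ 7) * N := by ring
            _ ≤ ℓ * N := mul_le_mul_of_nonneg_right hℓbig hN0.le
            _ = N * ℓ := by ring
  -- assemble
  have htot : (4 * 10 ^ 9 + 3 * 10 ^ 8 * C₂) * N / L ^ 4 + N / L ^ 4 =
      (4 * 10 ^ 9 + 3 * 10 ^ 8 * C₂ + 1) * N / L ^ 4 := by ring
  rw [← htot]
  exact add_le_add (hB.trans harith) hcorr


/-- **(10.15) summed over the blocks, grid started at `N^{1/10}`**: for `0 < ε ≤ 1` and
`0 < δ ≤ 1/4` and a fixed `h ≠ 0` there is `C` with `R_S(h, N, ε, N^{1/2−δ}) ≤ C N/(log N)³` for all large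
`N ≥ h` (each of the
`O(ε⁻¹ log N)` blocks has remainder `≪ N/(log N)⁴` by Theorem 10.7 — the large sieve and the
Siegel–Walfisz theorem, both PROVED in the tree; Chen obtains this mean value theorem for the switched
sequence in his Lemmas 5–7). Here `C = (4·10⁹ + 3·10⁸ C₂ + 1)(5/4)⁴(1/log(1+ε) + 1)` with the
Siegel–Walfisz constant `C₂` of exponent `20`. [cite: Nathanson1996, Thm 10.6 (proof, (10.15))] -/
theorem switchedRemainderS_le {h : ℕ} (hh0 : h ≠ 0) {ε δ : ℝ} (hε : 0 < ε) (hε1 : ε ≤ 1) (hδ : 0 < δ)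
    (hδ1 : δ ≤ 1 / 4) :
    ∃ C : ℝ, ∀ᶠ N : ℕ in atTop,
      switchedRemainderS h N ε ((N : ℝ) ^ (1 / 2 - δ)) ≤ C * N / Real.log N ^ 3 := by
  classical
  obtain ⟨C₂, hC₂0, hSW⟩ := swBound_of_siegel_walfisz
    Literature.NumberTheory.LFunctions.siegel_walfisz_holds
    (A₂ := ((20 : ℕ) : ℝ)) (by norm_num)
  set C₁ : ℝ := 4 * 10 ^ 9 + 3 * 10 ^ 8 * C₂ + 1 with hC₁
  have hC₁0 : 0 ≤ C₁ := by positivity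
  have hlog1 : 0 < Real.log (1 + ε) := Real.log_pos (by linarith)
  refine ⟨C₁ * (5 / 4) ^ 4 * (1 / Real.log (1 + ε) + 1), ?_⟩
  -- the eventual conditions
  have hlog : Tendsto (fun N : ℕ => Real.log N) atTop atTop :=
    Real.tendsto_log_atTop.comp (tendsto_natCast_atTop_atTop (R := ℝ))
  have hev1 : ∀ᶠ N : ℕ in atTop, (4 / 5 * Real.log N) ^ 18 ≤ (N : ℝ) ^ (1 / 20 : ℝ) := by
    have h18 := (eventually_log_rpow_le_rpow 18 (by norm_num : (0 : ℝ) < 1 / 20))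
    filter_upwards [(tendsto_natCast_atTop_atTop (R := ℝ)).eventually h18, eventually_ge_atTop 1]
      with N hN hN1
    rw [show (18 : ℝ) = ((18 : ℕ) : ℝ) by norm_num, Real.rpow_natCast] at hN
    have hlog0 : 0 ≤ Real.log N := Real.log_natCast_nonneg N
    have h45 : (4 / 5 * Real.log N) ^ 18 ≤ Real.log N ^ 18 :=
      pow_le_pow_left₀ (by positivity) (by linarith) 18
    exact h45.trans hN
  have hev2 : ∀ᶠ N : ℕ in atTop, 128 * (4 / 5 * Real.log N) ^ 6 ≤ (N : ℝ) ^ δ := by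
    have h1 := (eventually_log_rpow_le_rpow 6 (by linarith : (0 : ℝ) < δ / 2))
    have h2 := (tendsto_rpow_atTop (by linarith : (0 : ℝ) < δ / 2)).eventually_ge_atTop 128
    filter_upwards [(tendsto_natCast_atTop_atTop (R := ℝ)).eventually h1,
      (tendsto_natCast_atTop_atTop (R := ℝ)).eventually h2, eventually_ge_atTop 1] with N hN hN' hN1
    rw [show (6 : ℝ) = ((6 : ℕ) : ℝ) by norm_num, Real.rpow_natCast] at hN
    have hN0 : (0 : ℝ) < N := by exact_mod_cast hN1
    have hlog0 : 0 ≤ Real.log N := Real.log_natCast_nonneg N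
    have h45 : (4 / 5 * Real.log N) ^ 6 ≤ Real.log N ^ 6 :=
      pow_le_pow_left₀ (by positivity) (by linarith) 6
    have hlog6 : 0 ≤ (4 / 5 * Real.log N) ^ 6 := by positivity
    calc 128 * (4 / 5 * Real.log N) ^ 6 ≤ 128 * Real.log N ^ 6 := by linarith
      _ ≤ (N : ℝ) ^ (δ / 2) * (N : ℝ) ^ (δ / 2) :=
          mul_le_mul hN' hN (pow_nonneg hlog0 6) (by positivity)
      _ = (N : ℝ) ^ δ := by rw [← Real.rpow_add hN0]; ring_nf
  filter_upwards [eventually_ge_atTop (9 ^ 10), eventually_ge_atTop h, hlog.eventually_ge_atTop 40,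
    hev1, hev2] with N hN hhN hL40 hev1N hev2N
  have hN2 : 2 ≤ N := le_trans (by norm_num) hN
  have hN3 : 3 ≤ N := le_trans (by norm_num) hN
  have hNpos : 0 < N := by omega
  have hN0 : (0 : ℝ) < N := by exact_mod_cast hNpos
  have hL0 : 0 < Real.log N := by linarith
  have hL32 : 32 ≤ 4 / 5 * Real.log N := by linarith
  -- `R ≤ ∑_k (block sums) ≤ ∑_k C₁ N/L'⁴`
  have hblocks := switchedRemainderS_le_sum_blocks (h := h) hN2 hε ((N : ℝ) ^ (1 / 2 - δ))
  refine hblocks.trans ?_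
  have hper : ∀ k ∈ Finset.range (maxGridIndexT N ε + 1),
      ∑ d ∈ (Finset.range ⌈(N : ℝ) ^ (1 / 2 - δ)⌉₊).filter (· ∣ primesProdBelow (y N)),
          |(#((blockPrimesS h N ε k ×ˢ blockPairsS h N ε k).filter
              fun t : ℕ × ℕ × ℕ => d ∣ tripleDist h t) : ℝ) -
            shiftedPrimesDensity h d * #(blockPrimesS h N ε k ×ˢ blockPairsS h N ε k)| ≤
        C₁ * N / (4 / 5 * Real.log N) ^ 4 := by
    intro k hk
    have hk' : k ≤ maxGridIndexT N ε := Nat.lt_succ_iff.mp (Finset.mem_range.mp hk)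
    have hsub : blockProductsS h N ε k ⊆ Finset.Ioc 0 ⌈(N : ℝ) / gridLevelT N ε k⌉₊ := by
      intro m hm
      obtain ⟨hm1, hmlt, -, -⟩ := blockProductsS_props hNpos hε hm
      rw [Finset.mem_Ioc]
      refine ⟨hm1, ?_⟩
      have : m < ⌈(N : ℝ) / gridLevelT N ε k⌉₊ := Nat.lt_ceil.mpr hmlt
      omega
    refine (blockRemainderS_sum_le hNpos hε k _ hsub).trans ?_
    rw [hC₁]
    exact blockTotal_leS hC₂0 hSW hε hε1 hδ hδ1 hh0 hhN hN hL32 hev1N hev2N hk'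
  calc _ ≤ ∑ _k ∈ Finset.range (maxGridIndexT N ε + 1), C₁ * N / (4 / 5 * Real.log N) ^ 4 :=
        Finset.sum_le_sum hper
    _ = ((maxGridIndexT N ε : ℝ) + 1) * (C₁ * N / (4 / 5 * Real.log N) ^ 4) := by
        rw [Finset.sum_const, Finset.card_range, nsmul_eq_mul]; push_cast; ring
    _ ≤ ((1 / Real.log (1 + ε) + 1) * Real.log N) * (C₁ * N / (4 / 5 * Real.log N) ^ 4) :=
        mul_le_mul_of_nonneg_right (maxGridIndexT_add_one_le hN3 hε) (by positivity)
    _ = C₁ * (5 / 4) ^ 4 * (1 / Real.log (1 + ε) + 1) * N / Real.log N ^ 3 := by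
        field_simp


end Literature.NumberTheory.Sieve.Chen
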